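import Summits.KontsevichZagierPeriods.KontsevichZagierPeriods.Theses.IsogenyCertificates

/-!
# `EffectiveXMapChains` (stmt-KontsevichZagierPeriods-10664) — negative knowledge, part 4: the value of the x-map at infinity

Support file for the crux `IsogenyCertificates.EffectiveXMapChains` (cdisprove seat; self-contained,
imports only the Theses file; complements part 3 `Negative/Mechanism.lean`). For every datum
`(f, g, c)` of the crux (`W = f'g − fg' ≠ 0`, `c²·g·(f³ + A'fg² + B'g³) = (X³+AX+B)·W²`):
`wronskian_natDegree_le` (`deg f ≤ deg g = n ⇒ deg W ≤ 2n − 2`) and `limit_value_is_root`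
(`deg f ≤ deg g ⇒ P'(fₙ/gₙ) = 0`: the finite limit of `R = f/g` at `±∞` is a root of `P'`). This is
the evaluation the triage panel (TRIAGE-r1-1, "sharpen") asked to isolate: with it, all endpoint
values of `R` on the monotone pieces of `{P > 0}` — critical values, finite boundary images
(part 3), poles (`+∞`), and `R(±∞)` — lie in `{roots of P'} ∪ {+∞}`, so every piece maps onto a
whole component of `{P' > 0}` and the move count per datum is linear in its degree.

References: Silverman, *The Arithmetic of Elliptic Curves* (2009), III.4; Washington, *Elliptic
Curves* (2008), §2.9.
-/

noncomputable section

namespace Summit.KontsevichZagierPeriods.IsogenyCertificates.EffectiveXMapChainsNegative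

open Polynomial

variable {A B A' B' : ℤ} {f g : ℚ[X]} {c : ℚ}

/-- **The Wronskian drops two degrees**: if `deg f ≤ deg g = n ≥ 1` then
`deg (f'g − fg') ≤ 2n − 2` (the coefficients of `X^{2n−1}` of `f'g` and `fg'` are both `n·fₙ·gₙ`).
Hence a coprime datum of degree `N` cuts `{P > 0}` in at most `(N) + (2N − 2)` points. [folklore] -/
theorem wronskian_natDegree_le (hf : f.natDegree ≤ g.natDegree) (hn : 1 ≤ g.natDegree) :
    (derivative f * g - f * derivative g).natDegree ≤ 2 * g.natDegree - 2 := by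
  set n := g.natDegree with hn'
  have hf' : (derivative f).natDegree ≤ n - 1 :=
    (natDegree_derivative_le f).trans (Nat.sub_le_sub_right hf 1)
  have hg' : (derivative g).natDegree ≤ n - 1 := natDegree_derivative_le g
  have h1 : (derivative f * g).natDegree ≤ n - 1 + n :=
    natDegree_mul_le_of_le hf' le_rfl
  have h2 : (f * derivative g).natDegree ≤ n + (n - 1) :=
    natDegree_mul_le_of_le hf hg'
  have htop : (derivative f * g - f * derivative g).coeff (n - 1 + n) = 0 := by
    rw [coeff_sub, coeff_mul_add_eq_of_natDegree_le hf' le_rfl,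
      show n - 1 + n = n + (n - 1) by omega, coeff_mul_add_eq_of_natDegree_le hf hg',
      coeff_derivative, coeff_derivative, show n - 1 + 1 = n by omega]
    ring
  have hle : (derivative f * g - f * derivative g).natDegree ≤ n - 1 + n :=
    (natDegree_sub_le _ _).trans (max_le h1 (by simpa [add_comm] using h2))
  rw [natDegree_le_iff_coeff_eq_zero] at hle ⊢
  intro j hj
  rcases lt_or_eq_of_le (show n - 1 + n ≤ j by omega) with h | h
  · exact hle j (by exact_mod_cast h)
  · rw [← h]; exact htop

/-- **`R(∞)` is a 2-torsion abscissa of the target.** For a datum `(f, g, c)` with `deg f ≤ deg g`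
(so that `R = f/g` has the finite limit `L = fₙ/gₙ` at `±∞`, `n = deg g`; `L = 0` when
`deg f < deg g`): `P'(L) = L³ + A'L + B' = 0`. Proof: compare the coefficients of `X^{4n}` in
`c²·g·(f³ + A'fg² + B'g³) = P·W²`; on the right it vanishes since `deg W ≤ 2n − 2`
(`wronskian_natDegree_le`), on the left it is `c²·gₙ·(fₙ³ + A'fₙgₙ² + B'gₙ³)`. (Geometrically: the
point at infinity maps to `O'` or to a rational 2-torsion point, AEC III.4.) Together with part 3
(`Mechanism`: critical values and finite boundary images are roots of `P'`) this is the last of the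
four evaluations behind "every monotone piece of `{P>0}` maps onto a whole component of `{P'>0}`".
[cite: SilvermanAEC2009, III.4 (Remark 4.13.2)] -/
theorem limit_value_is_root (hW : derivative f * g - f * derivative g ≠ 0)
    (hI : C (c ^ 2) * g * (f ^ 3 + C (A' : ℚ) * f * g ^ 2 + C (B' : ℚ) * g ^ 3) =
      (X ^ 3 + C (A : ℚ) * X + C (B : ℚ)) * (derivative f * g - f * derivative g) ^ 2)
    (hc : c ≠ 0) (hfg : f.natDegree ≤ g.natDegree) :
    (f.coeff g.natDegree / g.leadingCoeff) ^ 3 + (A' : ℚ) * (f.coeff g.natDegree / g.leadingCoeff)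
      + (B' : ℚ) = 0 := by
  set n := g.natDegree with hn'
  have hg0 : g ≠ 0 := by rintro rfl; exact hW (by simp)
  have hgc : g.leadingCoeff ≠ 0 := leadingCoeff_ne_zero.mpr hg0
  have hn : 1 ≤ n := by
    -- if `n = 0` then `g` and `f` are constants and `W = 0`
    by_contra h0
    have hn0 : n = 0 := by omega
    have hf0 : f.natDegree = 0 := by omega
    apply hW
    rw [eq_C_of_natDegree_eq_zero hn0, eq_C_of_natDegree_eq_zero hf0]
    simp
  -- the coefficient of X^{4n} on the right vanishes
  have hWdeg := wronskian_natDegree_le hfg hn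
  have hR : ((X ^ 3 + C (A : ℚ) * X + C (B : ℚ)) *
      (derivative f * g - f * derivative g) ^ 2).coeff (4 * n) = 0 := by
    apply coeff_eq_zero_of_natDegree_lt
    have hP : (X ^ 3 + C (A : ℚ) * X + C (B : ℚ) : ℚ[X]).natDegree ≤ 3 := by
      refine (natDegree_add_le _ _).trans (max_le ((natDegree_add_le _ _).trans (max_le ?_ ?_)) ?_)
      · simp
      · exact (natDegree_C_mul_le _ _).trans (by simp)
      · simp
    have hW2 : ((derivative f * g - f * derivative g) ^ 2).natDegree ≤ 2 * (2 * n - 2) :=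
      natDegree_pow_le_of_le 2 hWdeg
    have := natDegree_mul_le_of_le hP hW2
    omega
  -- the coefficient of X^{4n} on the left is c² g_n (f_n³ + A' f_n g_n² + B' g_n³)
  have hQ : (f ^ 3 + C (A' : ℚ) * f * g ^ 2 + C (B' : ℚ) * g ^ 3).natDegree ≤ 3 * n := by
    refine (natDegree_add_le _ _).trans (max_le ((natDegree_add_le _ _).trans (max_le ?_ ?_)) ?_)
    · exact natDegree_pow_le_of_le 3 hfg |>.trans (by omega)
    · calc (C (A' : ℚ) * f * g ^ 2).natDegree ≤ (C (A' : ℚ) * f).natDegree + (g ^ 2).natDegree :=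
            natDegree_mul_le
        _ ≤ n + 2 * n := add_le_add ((natDegree_C_mul_le _ _).trans hfg) (natDegree_pow_le_of_le 2 le_rfl)
        _ = 3 * n := by ring
    · exact (natDegree_C_mul_le _ _).trans (natDegree_pow_le_of_le 3 le_rfl |>.trans (by omega))
  have hQc : (f ^ 3 + C (A' : ℚ) * f * g ^ 2 + C (B' : ℚ) * g ^ 3).coeff (3 * n) =
      f.coeff n ^ 3 + (A' : ℚ) * f.coeff n * g.coeff n ^ 2 + (B' : ℚ) * g.coeff n ^ 3 := by
    rw [coeff_add, coeff_add, coeff_pow_of_natDegree_le hfg, mul_assoc, coeff_C_mul,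
      show 3 * n = n + 2 * n by ring, coeff_mul_add_eq_of_natDegree_le hfg (natDegree_pow_le_of_le 2 le_rfl),
      coeff_pow_of_natDegree_le le_rfl, coeff_C_mul, show n + 2 * n = 3 * n by ring,
      coeff_pow_of_natDegree_le le_rfl]
    ring
  have hL : (C (c ^ 2) * g * (f ^ 3 + C (A' : ℚ) * f * g ^ 2 + C (B' : ℚ) * g ^ 3)).coeff (4 * n) =
      c ^ 2 * (g.coeff n * (f.coeff n ^ 3 + (A' : ℚ) * f.coeff n * g.coeff n ^ 2 +
        (B' : ℚ) * g.coeff n ^ 3)) := by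
    rw [mul_assoc, coeff_C_mul, show 4 * n = n + 3 * n by ring, coeff_mul_add_eq_of_natDegree_le le_rfl hQ, hQc]
  have key : c ^ 2 * (g.coeff n * (f.coeff n ^ 3 + (A' : ℚ) * f.coeff n * g.coeff n ^ 2 +
      (B' : ℚ) * g.coeff n ^ 3)) = 0 := by
    rw [← hL, hI, hR]
  have hgn : g.coeff n = g.leadingCoeff := rfl
  rw [hgn] at key
  have key' : f.coeff n ^ 3 + (A' : ℚ) * f.coeff n * g.leadingCoeff ^ 2 + (B' : ℚ) * g.leadingCoeff ^ 3 = 0 := by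
    rcases mul_eq_zero.mp key with h | h
    · exact absurd h (pow_ne_zero 2 hc)
    · rcases mul_eq_zero.mp h with h | h
      · exact absurd h hgc
      · exact h
  field_simp
  linear_combination key'

end Summit.KontsevichZagierPeriods.IsogenyCertificates.EffectiveXMapChainsNegative
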